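import Summits.Ventures.LatticeQCDFlow.Scoring.CalibrationTruths

/-!
# Wolff's automatic window, typed (I): the procedure, and its bias model is conservative on set C-1

HONEST FRAMING: exact (Metropolis-corrected) sampling algorithms for lattice gauge theory;
figures of merit are autocorrelation/cost numbers at stated couplings and volumes; no
continuum-physics claim.

Venture `LatticeQCDFlow` (cell pub-lqcd), sub-topic `Scoring`; FANOUT row 11 (`eng-scorerA`,
fitness scorer A).  NEW WORK of the cell (elementary real analysis about the frozen scorer's
windowing procedure), not a published result: U. Wolff, *Monte Carlo errors with less errors*,
Comput. Phys. Commun. 156 (2004) 143–153 [hep-lat/0306017] §3.3 is cited for the PROCEDURE (which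
the frozen scorer A 0.1.2 implements: `gamma.py` `_auto_window` l.81–97, `S = 3/2` frozen in FITNESS.md
§A / FITNESS-A.md A1; the frozen scorer B uses a Madras–Sokal window `c = 6` instead and is not the
subject here), nothing is taken from it as a fact.  With the companion file
`WolffWindowExistence` this closes the one row of HOME/eng-scorera/LEAN-COVERAGE-A.md (row 3) that
was 'NOT typed — calibrated numerically': the automatic-window procedure itself.

## The procedure (`wolffTau`, `wolffG`, `IsWolffWindow`)

Given the windowed estimates `τ̂_W = 1/2 + Σ_{t ≤ W} ρ̂(t)`, Wolff postulates that the remaining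
tail decays on the scale `τ_S(τ̂_W) = S / log((2 τ̂_W + 1)/(2 τ̂_W − 1))` (the exponential
autocorrelation time a PURE exponential ACF with that integrated time would have, times `S`) and
stops at the first `W ≥ 1` with `g(W) = exp(−W/τ_S(τ̂_W)) − τ_S(τ̂_W)/√(W N) < 0`.

## What it guarantees on C-1 (population version: the exact curve `W ↦ τ_W` of `ρ(t) = r^t`, no noise)

* `wolffTau_tauInt_geometric`: the hypothesis is EXACT on C-1 — at the true `τ_int = (1+r)/(2(1−r))`
  the ratio is `1/r` (`wolffRatio_tauInt_geometric`), so `τ_S(τ_int) = S · τ_exp` with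
  `τ_exp = 1/log(1/r)`, `r^W = exp(−W/τ_exp)` (`tauExp`, `pow_eq_exp_tauExp`).
* From the TRUNCATED sum the ratio is `c_W / r` with `c_W = (1 − r^(W+1))/(1 − r^W) ∈ (1, 1 + 1/W]`
  (`wolffRatio_window_geometric`, `one_lt_corrFactor`, `corrFactor_le`), hence
  `τ_S(τ_W) = S/(log(1/r) + log c_W)` (`wolffTau_window_geometric`) is positive and strictly below
  `S τ_exp` (`wolffTau_window_pos`, `wolffTau_window_lt`): the truncated sum UNDER-states the decay
  scale — the reason for `S > 1` — by a controlled amount, `W/τ_S(τ_W) ≤ (W/τ_exp + 1)/S`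
  (`div_wolffTau_window_le`).
* The relative truncation bias `relBias W = (τ_int − τ_W)/τ_int` is `2 r^(W+1)/(1+r)
  = (2r/(1+r)) exp(−W/τ_exp) < exp(−W/τ_exp)` (`relBias_geometric`, `relBias_geometric_eq`,
  `relBias_geometric_lt_exp`).
* **`relBias_lt_wolffModel`**: for `S > 1` and every `W ≥ τ_exp/(S − 1)` (at `S = 3/2`: `W ≥ 2 τ_exp`,
  `relBias_lt_wolffModel_frozen`) Wolff's model evaluated AS THE SCORER EVALUATES IT dominates the
  true bias: `relBias W < exp(−W/τ_S(τ_W))`.  (At `S = 1` there is no such `W`.)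
* **`relBias_lt_of_wolffG_neg`**: so wherever the criterion is negative at such a `W`, the bias left
  in `τ̂_W` is `< τ_S(τ_W)/√(W N) < S τ_exp/√(W N)`.

The companion file `WolffWindowExistence` adds: `g = −τ_S E′` for Wolff's total-error proxy, the
bias-versus-statistical-error form, termination / existence / uniqueness of the automatic window on
the C-1 curve, and the end-to-end statement at `S = 3/2` for `N ≥ (9/4) e⁴ τ_exp²`.

NOT covered (said plainly): sampling noise in `ρ̂` (this is the population curve), the bias-correction
step `C(W) ↦ C(W)(1 + (2W+1)/N)` gamma.py applies after choosing `W`, non-exponential ACFs (C-1b's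
two-scale trap defeats any single-scale hypothesis by design — `tauInt_mixture`), and the finite
`W_max` of real data.
-/

namespace Summit.Ventures.LatticeQCDFlow.Scoring

open scoped BigOperators
open Real

/-! ## The procedure -/

/-- Wolff's decay-scale hypothesis (CPC 156 (2004) §3.3; scorer A `gamma.py` `_auto_window`
l.90–91, UWerr's `tauW`): the exponential autocorrelation time implied by an integrated
autocorrelation time `τi > 1/2` IF the autocorrelation function were a pure exponential, inflated by
the factor `S` (frozen at `S = 3/2` in scorer A): `τ_S(τi) = S / log((2 τi + 1)/(2 τi − 1))`. -/
noncomputable def wolffTau (S τi : ℝ) : ℝ :=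
  S / Real.log ((2 * τi + 1) / (2 * τi - 1))

/-- Wolff's window criterion `g(W) = exp(−W/τ_S(τ̂_W)) − τ_S(τ̂_W)/√(W·N)` (gamma.py l.93); the
automatic window is the first `W ≥ 1` with `g(W) < 0` (l.94–97).  Arguments: `S`, the sample count
`N`, the window `W`, and the windowed integrated autocorrelation time `τi = τ̂_W` read at that window. -/
noncomputable def wolffG (S N : ℝ) (W : ℕ) (τi : ℝ) : ℝ :=
  Real.exp (-(W : ℝ) / wolffTau S τi) - wolffTau S τi / Real.sqrt (W * N)

/-- `W` is THE automatic window of the curve `W ↦ τ̂_W` (`τW`): the first `W ≥ 1` at which the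
criterion is negative (gamma.py `_auto_window` returns exactly this `W`, or fails if none `≤ W_max`). [ours] -/
def IsWolffWindow (S N : ℝ) (τW : ℕ → ℝ) (W : ℕ) : Prop :=
  1 ≤ W ∧ wolffG S N W (τW W) < 0 ∧ ∀ W', 1 ≤ W' → W' < W → 0 ≤ wolffG S N W' (τW W')

/-- The exponential autocorrelation time of the geometric ACF `t ↦ r^t`, `0 < r < 1`:
`τ_exp = 1 / log(1/r)`, i.e. `r^t = exp(−t/τ_exp)`. -/
noncomputable def tauExp (r : ℝ) : ℝ :=
  1 / Real.log (1 / r)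

/-! ## The hypothesis is exact on C-1 -/

/-- `τ_exp > 0` for `0 < r < 1`. -/
theorem tauExp_pos {r : ℝ} (hr0 : 0 < r) (hr1 : r < 1) : 0 < tauExp r :=
  div_pos one_pos (Real.log_pos (one_lt_one_div hr0 hr1))

/-- `r^W = exp(−W/τ_exp)`: the geometric ACF IS a pure exponential with decay scale `τ_exp`. -/
theorem pow_eq_exp_tauExp {r : ℝ} (hr0 : 0 < r) (hr1 : r < 1) (W : ℕ) :
    r ^ W = Real.exp (-(W : ℝ) / tauExp r) := by
  have hlog : Real.log (1 / r) = -Real.log r := by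
    rw [one_div, Real.log_inv]
  have : -(W : ℝ) / tauExp r = (W : ℝ) * Real.log r := by
    unfold tauExp
    rw [hlog]
    have hne : Real.log r ≠ 0 := by
      have := Real.log_neg hr0 hr1
      exact ne_of_lt this
    field_simp
  rw [this, Real.exp_nat_mul, Real.exp_log hr0]

/-- On C-1 the ratio in Wolff's hypothesis is exactly `1/r`:
`(2 τ_int + 1)/(2 τ_int − 1) = 1/r` for `τ_int = (1 + r)/(2 (1 − r))`. -/
theorem wolffRatio_tauInt_geometric {r : ℝ} (hr0 : 0 < r) (hr1 : r < 1) :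
    (2 * tauInt (fun t => r ^ t) + 1) / (2 * tauInt (fun t => r ^ t) - 1) = 1 / r := by
  have habs : |r| < 1 := abs_lt.mpr ⟨by linarith, hr1⟩
  rw [tauInt_geometric habs]
  have h1 : (1 : ℝ) - r ≠ 0 := by
    intro h; linarith
  have hnum : 2 * ((1 + r) / (2 * (1 - r))) + 1 = 2 / (1 - r) := by
    field_simp; ring
  have hden : 2 * ((1 + r) / (2 * (1 - r))) - 1 = 2 * r / (1 - r) := by
    field_simp; ring
  rw [hnum, hden, eq_div_iff hr0.ne']
  field_simp

/-- **Wolff's hypothesis is EXACT on the calibration family C-1**: feeding the TRUE integrated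
autocorrelation time of `t ↦ r^t` into `τ_S` returns `S · τ_exp` — at `S = 1` precisely the decay
scale, at the frozen `S = 3/2` a deliberate 50 % inflation of it. -/
theorem wolffTau_tauInt_geometric (S : ℝ) {r : ℝ} (hr0 : 0 < r) (hr1 : r < 1) :
    wolffTau S (tauInt (fun t => r ^ t)) = S * tauExp r := by
  unfold wolffTau tauExp
  rw [wolffRatio_tauInt_geometric hr0 hr1]
  ring

/-! ## What the procedure computes from the TRUNCATED sum on C-1

The scorer does not know `τ_int`; it feeds the WINDOWED value `τ̂_W` into `τ_S`.  On C-1 (population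
version: `τ̂_W` = the exact windowed sum `τ_W = 1/2 + Σ_{t ≤ W} r^t`, no noise) this is again in closed
form: the ratio is `(1/r) · c_W` with a correction factor `c_W = (1 − r^(W+1))/(1 − r^W) ∈ (1, 1 + 1/W]`,
so the implied decay scale `τ_S(τ_W) = S / (log(1/r) + log c_W)` UNDER-states `S·τ_exp`, by a
controlled amount: `W / τ_S(τ_W) ≤ (W/τ_exp + 1)/S`. -/

/-- The correction factor `c_W = (1 − r^(W+1)) / (1 − r^W)`. -/
noncomputable def corrFactor (r : ℝ) (W : ℕ) : ℝ :=
  (1 - r ^ (W + 1)) / (1 - r ^ W)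

/-- `1 − r^W > 0` for `0 ≤ r < 1`, `W ≥ 1`. -/
theorem one_sub_pow_pos {r : ℝ} (hr0 : 0 ≤ r) (hr1 : r < 1) {W : ℕ} (hW : 1 ≤ W) :
    0 < 1 - r ^ W := by
  have : r ^ W < 1 := pow_lt_one₀ hr0 hr1 (by omega)
  linarith

/-- On C-1 the windowed ratio is `(2 τ_W + 1)/(2 τ_W − 1) = c_W / r` (`W ≥ 1`, `0 < r < 1`). -/
theorem wolffRatio_window_geometric {r : ℝ} (hr0 : 0 < r) (hr1 : r < 1) {W : ℕ} (hW : 1 ≤ W) :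
    (2 * tauIntWindow (fun t => r ^ t) W + 1) / (2 * tauIntWindow (fun t => r ^ t) W - 1)
      = corrFactor r W / r := by
  rw [tauIntWindow_geometric hr1.ne W, corrFactor]
  have h1 : (1 : ℝ) - r ≠ 0 := by intro h; linarith
  have hrW : (1 : ℝ) - r ^ W ≠ 0 := (one_sub_pow_pos hr0.le hr1 hW).ne'
  have hnum : 2 * (1 / 2 + r * (1 - r ^ W) / (1 - r)) + 1 = 2 * (1 - r ^ (W + 1)) / (1 - r) := by
    field_simp; ring
  have hden : 2 * (1 / 2 + r * (1 - r ^ W) / (1 - r)) - 1 = 2 * (r * (1 - r ^ W)) / (1 - r) := by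
    field_simp; ring
  rw [hnum, hden, div_div_div_cancel_right₀ h1]
  field_simp

/-- `c_W > 1`. -/
theorem one_lt_corrFactor {r : ℝ} (hr0 : 0 < r) (hr1 : r < 1) {W : ℕ} (hW : 1 ≤ W) :
    1 < corrFactor r W := by
  unfold corrFactor
  rw [one_lt_div (one_sub_pow_pos hr0.le hr1 hW)]
  have : r ^ (W + 1) < r ^ W := by
    rw [pow_succ]
    exact mul_lt_of_lt_one_right (pow_pos hr0 W) hr1
  linarith

/-- `Σ_{t<W} r^t ≥ W · r^W` for `0 ≤ r ≤ 1` (every term is at least the last one). -/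
theorem geom_sum_ge_card_mul_pow {r : ℝ} (hr0 : 0 ≤ r) (hr1 : r ≤ 1) (W : ℕ) :
    (W : ℝ) * r ^ W ≤ ∑ t ∈ Finset.range W, r ^ t := by
  have h : ∀ t ∈ Finset.range W, r ^ W ≤ r ^ t := by
    intro t ht
    exact pow_le_pow_of_le_one hr0 hr1 (Finset.mem_range.mp ht).le
  calc (W : ℝ) * r ^ W = ∑ _t ∈ Finset.range W, r ^ W := by simp
    _ ≤ ∑ t ∈ Finset.range W, r ^ t := Finset.sum_le_sum h

/-- `c_W ≤ 1 + 1/W`: `c_W − 1 = r^W (1 − r)/(1 − r^W) = r^W / Σ_{t<W} r^t ≤ r^W / (W r^W)`. -/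
theorem corrFactor_le {r : ℝ} (hr0 : 0 < r) (hr1 : r < 1) {W : ℕ} (hW : 1 ≤ W) :
    corrFactor r W ≤ 1 + 1 / W := by
  have hW0 : (0 : ℝ) < W := by exact_mod_cast hW
  have h1W := one_sub_pow_pos hr0.le hr1 hW
  have hgs : ∑ t ∈ Finset.range W, r ^ t = (1 - r ^ W) / (1 - r) := by
    rw [geom_sum_eq hr1.ne W]
    have h1 : (1 : ℝ) - r ≠ 0 := by intro h; linarith
    have h2 : r - 1 ≠ 0 := by intro h; linarith
    field_simp
    ring
  have hsum_pos : 0 < ∑ t ∈ Finset.range W, r ^ t := by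
    rw [hgs]; exact div_pos h1W (by linarith)
  -- c_W = 1 + r^W / Σ
  have hc : corrFactor r W = 1 + r ^ W / ∑ t ∈ Finset.range W, r ^ t := by
    rw [hgs, corrFactor]
    have h1 : (1 : ℝ) - r ≠ 0 := by intro h; linarith
    field_simp
    ring
  rw [hc, add_le_add_iff_left, div_le_div_iff₀ hsum_pos hW0]
  have := geom_sum_ge_card_mul_pow hr0.le hr1.le W
  nlinarith [pow_pos hr0 W]

/-- The log of the windowed ratio splits as `log(1/r) + log c_W`. -/
theorem log_wolffRatio_window {r : ℝ} (hr0 : 0 < r) (hr1 : r < 1) {W : ℕ} (hW : 1 ≤ W) :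
    Real.log ((2 * tauIntWindow (fun t => r ^ t) W + 1) / (2 * tauIntWindow (fun t => r ^ t) W - 1))
      = Real.log (1 / r) + Real.log (corrFactor r W) := by
  rw [wolffRatio_window_geometric hr0 hr1 hW, div_eq_mul_one_div, mul_comm,
    Real.log_mul (by positivity) (by linarith [one_lt_corrFactor hr0 hr1 hW])]

/-- `0 < log c_W ≤ 1/W`. -/
theorem log_corrFactor_bounds {r : ℝ} (hr0 : 0 < r) (hr1 : r < 1) {W : ℕ} (hW : 1 ≤ W) :
    0 < Real.log (corrFactor r W) ∧ Real.log (corrFactor r W) ≤ 1 / W := by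
  have h1 := one_lt_corrFactor hr0 hr1 hW
  refine ⟨Real.log_pos h1, ?_⟩
  have h2 := Real.log_le_sub_one_of_pos (by linarith : 0 < corrFactor r W)
  have h3 := corrFactor_le hr0 hr1 hW
  linarith

/-- **The implied decay scale from the truncated sum, in closed form**:
`τ_S(τ_W) = S / (log(1/r) + log c_W)` on C-1. -/
theorem wolffTau_window_geometric (S : ℝ) {r : ℝ} (hr0 : 0 < r) (hr1 : r < 1) {W : ℕ} (hW : 1 ≤ W) :
    wolffTau S (tauIntWindow (fun t => r ^ t) W) = S / (Real.log (1 / r) + Real.log (corrFactor r W)) := by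
  unfold wolffTau
  rw [log_wolffRatio_window hr0 hr1 hW]

/-- It is positive (`S > 0`) … -/
theorem wolffTau_window_pos {S r : ℝ} (hS : 0 < S) (hr0 : 0 < r) (hr1 : r < 1) {W : ℕ} (hW : 1 ≤ W) :
    0 < wolffTau S (tauIntWindow (fun t => r ^ t) W) := by
  rw [wolffTau_window_geometric S hr0 hr1 hW]
  exact div_pos hS (by linarith [Real.log_pos (one_lt_one_div hr0 hr1), (log_corrFactor_bounds hr0 hr1 hW).1])

/-- … and strictly BELOW `S · τ_exp` = the value at the true `τ_int` (`wolffTau_tauInt_geometric`):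
the truncated sum under-states the decay scale — the reason the factor `S > 1` exists. -/
theorem wolffTau_window_lt (S : ℝ) (hS : 0 < S) {r : ℝ} (hr0 : 0 < r) (hr1 : r < 1) {W : ℕ} (hW : 1 ≤ W) :
    wolffTau S (tauIntWindow (fun t => r ^ t) W) < S * tauExp r := by
  rw [wolffTau_window_geometric S hr0 hr1 hW, tauExp, mul_one_div]
  have hl := Real.log_pos (one_lt_one_div hr0 hr1)
  have hc := (log_corrFactor_bounds hr0 hr1 hW).1
  exact div_lt_div_of_pos_left hS hl (by linarith)

/-- **How much it under-states**: `W / τ_S(τ_W) ≤ (W/τ_exp + 1)/S`, i.e. the procedure's exponent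
`W/τ_S(τ_W)` exceeds the true-scale exponent `W/(S τ_exp)` by at most `1/S`. -/
theorem div_wolffTau_window_le {S r : ℝ} (hS : 0 < S) (hr0 : 0 < r) (hr1 : r < 1) {W : ℕ} (hW : 1 ≤ W) :
    (W : ℝ) / wolffTau S (tauIntWindow (fun t => r ^ t) W) ≤ ((W : ℝ) / tauExp r + 1) / S := by
  rw [wolffTau_window_geometric S hr0 hr1 hW, tauExp]
  have hW0 : (0 : ℝ) < W := by exact_mod_cast hW
  have hl := Real.log_pos (one_lt_one_div hr0 hr1)
  have ⟨hc0, hc1⟩ := log_corrFactor_bounds hr0 hr1 hW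
  have hWc : (W : ℝ) * Real.log (corrFactor r W) ≤ 1 := by
    have := mul_le_mul_of_nonneg_left hc1 hW0.le
    rwa [mul_one_div_cancel hW0.ne'] at this
  have hL : (W : ℝ) / (S / (Real.log (1 / r) + Real.log (corrFactor r W)))
      = (W * Real.log (1 / r) + W * Real.log (corrFactor r W)) / S := by
    field_simp
  have hR : ((W : ℝ) / (1 / Real.log (1 / r)) + 1) / S = (W * Real.log (1 / r) + 1) / S := by
    field_simp
  rw [hL, hR, div_le_div_iff_of_pos_right hS]
  linarith

/-! ## The relative truncation bias, and Wolff's model of it is conservative on C-1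

Wolff's criterion treats `exp(−W/τ)` as (an upper bound for) the RELATIVE systematic error of the
windowed sum.  On C-1 the relative truncation bias is exactly `(2r/(1+r)) · exp(−W/τ_exp)`
(`relBias_geometric_eq`), strictly below `exp(−W/τ_exp)`.  The procedure, however, evaluates the
model at the UNDER-stated scale `τ_S(τ_W)` of the previous section; the theorem
`relBias_lt_wolffModel` says the model still dominates the true bias as soon as
`W ≥ τ_exp/(S − 1)` — at the frozen `S = 3/2`, for every window `W ≥ 2 τ_exp`.  (At `S = 1` no such
guarantee exists: the correction `c_W` makes the model under-state the bias at every finite `W`.) -/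

/-- Relative truncation bias of the window `W`: `(τ_int − τ_W)/τ_int`. -/
noncomputable def relBias (ρ : ℕ → ℝ) (W : ℕ) : ℝ :=
  (tauInt ρ - tauIntWindow ρ W) / tauInt ρ

/-- On C-1: `relBias W = 2 r^(W+1)/(1 + r)`. -/
theorem relBias_geometric {r : ℝ} (hr0 : 0 < r) (hr1 : r < 1) (W : ℕ) :
    relBias (fun t => r ^ t) W = 2 * r ^ (W + 1) / (1 + r) := by
  have habs : |r| < 1 := abs_lt.mpr ⟨by linarith, hr1⟩
  rw [relBias, tauInt_sub_tauIntWindow_geometric habs W, tauInt_geometric habs]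
  have h1 : (1 : ℝ) - r ≠ 0 := by intro h; linarith
  have h2 : (1 : ℝ) + r ≠ 0 := by intro h; linarith
  field_simp

/-- … `= (2r/(1+r)) · exp(−W/τ_exp)`. -/
theorem relBias_geometric_eq {r : ℝ} (hr0 : 0 < r) (hr1 : r < 1) (W : ℕ) :
    relBias (fun t => r ^ t) W = 2 * r / (1 + r) * Real.exp (-(W : ℝ) / tauExp r) := by
  rw [relBias_geometric hr0 hr1, ← pow_eq_exp_tauExp hr0 hr1 W, pow_succ]
  ring

/-- The relative bias is positive … -/
theorem relBias_geometric_pos {r : ℝ} (hr0 : 0 < r) (hr1 : r < 1) (W : ℕ) :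
    0 < relBias (fun t => r ^ t) W := by
  rw [relBias_geometric hr0 hr1]
  positivity

/-- … and strictly below the pure-exponential model at the TRUE scale: `relBias W < exp(−W/τ_exp) = r^W`. -/
theorem relBias_geometric_lt_exp {r : ℝ} (hr0 : 0 < r) (hr1 : r < 1) (W : ℕ) :
    relBias (fun t => r ^ t) W < Real.exp (-(W : ℝ) / tauExp r) := by
  rw [relBias_geometric_eq hr0 hr1]
  have hlt : 2 * r / (1 + r) < 1 := by
    rw [div_lt_one (by linarith)]; linarith
  have hpos : 0 < Real.exp (-(W : ℝ) / tauExp r) := Real.exp_pos _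
  calc 2 * r / (1 + r) * Real.exp (-(W : ℝ) / tauExp r)
      < 1 * Real.exp (-(W : ℝ) / tauExp r) := mul_lt_mul_of_pos_right hlt hpos
    _ = Real.exp (-(W : ℝ) / tauExp r) := one_mul _

/-- **Wolff's bias model, evaluated exactly as the scorer evaluates it (at the scale implied by the
WINDOWED sum), dominates the true relative truncation bias on C-1 for every `W ≥ τ_exp/(S − 1)`**
(`S > 1`; at the frozen `S = 3/2`: every `W ≥ 2 τ_exp`). -/
theorem relBias_lt_wolffModel {S r : ℝ} (hS : 1 < S) (hr0 : 0 < r) (hr1 : r < 1) {W : ℕ} (hW : 1 ≤ W)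
    (hWlarge : tauExp r / (S - 1) ≤ W) :
    relBias (fun t => r ^ t) W
      < Real.exp (-(W : ℝ) / wolffTau S (tauIntWindow (fun t => r ^ t) W)) := by
  have hS0 : 0 < S := by linarith
  have hτe := tauExp_pos hr0 hr1
  refine (relBias_geometric_lt_exp hr0 hr1 W).trans_le ?_
  rw [Real.exp_le_exp, neg_div, neg_div, neg_le_neg_iff]
  refine (div_wolffTau_window_le hS0 hr0 hr1 hW).trans ?_
  -- (W/τe + 1)/S ≤ W/τe  ⟸  τe ≤ (S − 1) W
  rw [div_le_iff₀ hS0]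
  have h1 : tauExp r ≤ (S - 1) * W := by
    rwa [div_le_iff₀' (by linarith)] at hWlarge
  have h2 : 1 ≤ (S - 1) * ((W : ℝ) / tauExp r) := by
    rw [← mul_div_assoc, le_div_iff₀ hτe, one_mul]
    exact h1
  nlinarith [h2]

/-- At the frozen `S = 3/2` the hypothesis reads `2 τ_exp ≤ W`. -/
theorem relBias_lt_wolffModel_frozen {r : ℝ} (hr0 : 0 < r) (hr1 : r < 1) {W : ℕ} (hW : 1 ≤ W)
    (hWlarge : 2 * tauExp r ≤ W) :
    relBias (fun t => r ^ t) W
      < Real.exp (-(W : ℝ) / wolffTau (3 / 2) (tauIntWindow (fun t => r ^ t) W)) := by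
  refine relBias_lt_wolffModel (by norm_num) hr0 hr1 hW ?_
  have : tauExp r / (3 / 2 - 1) = 2 * tauExp r := by ring
  rwa [this]

/-- **What the stopping rule buys on C-1.**  If the criterion is negative at a window
`W ≥ τ_exp/(S − 1)` — in particular at the automatic window whenever it is that large — the relative
truncation bias left in `τ̂_W` is below `τ_S(τ_W)/√(W N)`, hence below `S τ_exp/√(W N)`. -/
theorem relBias_lt_of_wolffG_neg {S N r : ℝ} (hS : 1 < S) (hN : 0 < N) (hr0 : 0 < r) (hr1 : r < 1)
    {W : ℕ} (hW : 1 ≤ W) (hWlarge : tauExp r / (S - 1) ≤ W)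
    (hg : wolffG S N W (tauIntWindow (fun t => r ^ t) W) < 0) :
    relBias (fun t => r ^ t) W < wolffTau S (tauIntWindow (fun t => r ^ t) W) / Real.sqrt (W * N) ∧
      wolffTau S (tauIntWindow (fun t => r ^ t) W) / Real.sqrt (W * N) < S * tauExp r / Real.sqrt (W * N) := by
  have hS0 : 0 < S := by linarith
  have hW0 : (0 : ℝ) < W := by exact_mod_cast hW
  have hsqrt : 0 < Real.sqrt (W * N) := Real.sqrt_pos.mpr (mul_pos hW0 hN)
  refine ⟨?_, div_lt_div_of_pos_right (wolffTau_window_lt S hS0 hr0 hr1 hW) hsqrt⟩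
  have h := relBias_lt_wolffModel hS hr0 hr1 hW hWlarge
  unfold wolffG at hg
  linarith

end Summit.Ventures.LatticeQCDFlow.Scoring
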